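import Summits.QuantumAdvantage.QuantumAdvantage.Theorems.RankDialE2
import HarnessLib

/-!
# RankDial (F1) — §11 the MIN-MASS of a sketch (`minMass`, the laws `MassRank`, `MassRankLin`, `MassRankSharp`, `MassZeroBound`) and §11bis the SHARP fibre theorem `window_bound_of_massRank`

TARGET BY NAME (cell decomp-qadv, RESIDUAL MODE): item stmt-QuantumAdvantage-23109
`Summit.QuantumAdvantage.QuantumAdvantage.Theses.OddPrimeWalk.ManyReadersSqrtOdd`, through rung R5 = `AdviceFreeQNC0.WalkHardFLinSel p`.
This file SUPPORTS the item (`--supports`); it does not close it.  Declaration bodies are byte-identical to the cell node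
«OlsonDial» (decomp-qadv lens-1 «grading / quantitative ladder», generation 26; node file sha256 6d975657…), cut into
≤ 400-line parts E1 (§7–§8) → E2 (§9–§10) → F1 (§11, §11bis) → F2 (§11ter) → F3 (§12); see part E1 for the whole node.
-/

set_option linter.dupNamespace false
set_option autoImplicit false

noncomputable section
open Classical

namespace Summit.QuantumAdvantage.QuantumAdvantage.Theorems.RankDial

open Finset
open Summit.QuantumAdvantage.AdviceFreeQNC0
open Literature.Computability.MetaComplexity Literature.Computability.MetaComplexity.Smolensky

/-! ### §11 The MIN-MASS law — the sharp window-only quantity (refines part B's `EquiRank`) -/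

section MinMass
variable {p : ℕ}

/-- the fibre `{v ∈ {0,1}^ℓ : Φv = x}` -/
def fib {d ℓ : ℕ} (Φ : Fin d → Fin ℓ → ZMod p) (x : Fin d → ZMod p) : Finset (Fin ℓ → Bool) :=
  univ.filter fun v => skt Φ v = x

/-- `n_r(x) = #{v : Φv = x, |v| ≡ r (mod 3)}` -/
def classCount {d ℓ : ℕ} (Φ : Fin d → Fin ℓ → ZMod p) (x : Fin d → ZMod p) (r : ℕ) : ℕ :=
  ((fib Φ x).filter fun v => wt v % 3 = r).card

/-- `min_r n_r(x)` -/
def minClass {d ℓ : ℕ} (Φ : Fin d → Fin ℓ → ZMod p) (x : Fin d → ZMod p) : ℕ :=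
  min (min (classCount Φ x 0) (classCount Φ x 1)) (classCount Φ x 2)

/-- **The min-mass of a sketch**: `M(Φ) = Σ_x min_r n_r(x)` over the sketch values `x = Φv` that occur.  It is the
EXACT number of window contents a cut-free-window strategy reading the window through `Φ` must lose on each outside
fibre (`win_fibre_add_minMass_le`; a strategy wins at `v` iff `|v| mod 3` lies in a set `W(Φv)` of at most two classes). -/
def minMass {d ℓ : ℕ} (Φ : Fin d → Fin ℓ → ZMod p) : ℕ :=
  ∑ x ∈ univ.image (skt Φ), minClass Φ x

/-- **The min-mass law at rank `r`**: for all large `ℓ`, every sketch of `d ≤ r(ℓ)` rows has `M(Φ) ≥ 2^ℓ/C`.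
[PROVED at `r(ℓ) = ℓ/E` (`massRank_of_equiRank` + part C); FALSE at `r(ℓ) = ℓ/(p−1)` (`not_massRank_block`);
weaker than `EquiRank p r` and still sufficient for the window pieces (`window_bound_of_massRank`).] -/
def MassRank (p : ℕ) (r : ℕ → ℕ) : Prop :=
  ∃ C ℓ₀ : ℕ, ∀ ℓ ≥ ℓ₀, ∀ d ≤ r ℓ, ∀ Φ : Fin d → Fin ℓ → ZMod p, 2 ^ ℓ ≤ C * minMass Φ

/-- **RUNG `MassRankLin p`** — linear rank.  [PROVED for every prime `p ≥ 5` (`massRankLin_odd`).] -/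
def MassRankLin (p : ℕ) : Prop := ∃ E : ℕ, 0 < E ∧ MassRank p (fun ℓ => ℓ / E)

/-- **CONJECTURE `MassRankSharp p`** — the min-mass law at every rank fraction below `1/(p−1)`.  [UNDECIDED ·
INSTRUMENTABLE; implied by `EquiRankSharp p` (`massRank_of_equiRank`); the weakest window-only law that would give the
low-rank pieces up to the ceiling `1/(p−1)`; why it might fail: a sketch of rank `ℓ/D`, `D ≥ p`, almost all of whose
fibres nearly miss a class — the fat-block sketches (`minMass_fatBlock_eq_zero`) do so only up to `ℓ = (p−1)d + p`.] -/
def MassRankSharp (p : ℕ) : Prop := ∀ D : ℕ, p - 1 < D → MassRank p (fun ℓ => ℓ / D)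

/-- **CONJECTURE `MassZeroBound p`** — the `ε = 0` end of the min-mass law: a `d`-row sketch EVERY fibre of which
misses a weight class (`M(Φ) = 0`) has `ℓ ≤ (p−1)d + p`.  [DECIDED at `d = 1`: the threshold is EXACTLY `2p − 1`
(`massZero_threshold_d1`: `M = 0` forces `ℓ ≤ 2p − 1`, and the fat block `Φ = 𝟙` on `2p − 1` bits has `M = 0`);
PROVED in the weak form `ℓ ≤ 2(p−1)d + 1` for every `d` (`le_of_minMass_eq_zero`, two disjoint collisions);
the conjectured value `(p−1)d + p` is what one fat block plus `d − 1` blocks of size `p − 1` achieve (memo §1);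
UNDECIDED · INSTRUMENTABLE for `d ≥ 2` (first open cell `p = 5, d = 2`: is there a sketch on `14 ≤ ℓ ≤ 17` bits with
`M = 0`?).] -/
def MassZeroBound (p : ℕ) : Prop :=
  ∀ (ℓ d : ℕ) (Φ : Fin d → Fin ℓ → ZMod p), minMass Φ = 0 → ℓ ≤ (p - 1) * d + p

/-- `min_r n_r(x) ≤ n_r(x)` -/
theorem minClass_le {d ℓ : ℕ} (Φ : Fin d → Fin ℓ → ZMod p) (x : Fin d → ZMod p) (r : ℕ) (hr : r < 3) :
    minClass Φ x ≤ classCount Φ x r := by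
  unfold minClass
  interval_cases r <;> omega

/-- the class counts of a fibre add up to its size -/
theorem sum_classCount {d ℓ : ℕ} (Φ : Fin d → Fin ℓ → ZMod p) (x : Fin d → ZMod p) :
    classCount Φ x 0 + classCount Φ x 1 + classCount Φ x 2 = (fib Φ x).card := by
  have h := Finset.card_eq_sum_card_fiberwise (s := fib Φ x) (t := range 3) (f := fun v => wt v % 3)
    (fun v _ => Finset.mem_coe.2 (Finset.mem_range.2 (Nat.mod_lt _ (by norm_num))))
  rw [Finset.sum_range_succ, Finset.sum_range_succ, Finset.sum_range_succ, Finset.sum_range_zero, zero_add] at h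
  exact h.symm

/-- the fibres partition the cube -/
theorem sum_card_fib {d ℓ : ℕ} (Φ : Fin d → Fin ℓ → ZMod p) :
    ∑ x ∈ univ.image (skt Φ), (fib Φ x).card = 2 ^ ℓ := by
  have h := Finset.card_eq_sum_card_image (skt Φ) (univ : Finset (Fin ℓ → Bool))
  rw [Finset.card_univ, Fintype.card_fun, Fintype.card_bool, Fintype.card_fin] at h
  exact h.symm

/-- **The pointwise bound**: a set of window contents inside ONE fibre that misses a weight class `r₀` has at
most `#fibre − min_r n_r(x)` elements. -/
theorem card_add_minClass_le {d ℓ : ℕ} (Φ : Fin d → Fin ℓ → ZMod p) (x : Fin d → ZMod p)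
    (S : Finset (Fin ℓ → Bool)) (r₀ : ℕ) (hr₀ : r₀ < 3) (hS : ∀ v ∈ S, skt Φ v = x ∧ wt v % 3 ≠ r₀) :
    S.card + minClass Φ x ≤ (fib Φ x).card := by
  have hsub : S ⊆ (fib Φ x).filter fun v => ¬ (wt v % 3 = r₀) := by
    intro v hv
    unfold fib
    rw [Finset.mem_filter, Finset.mem_filter]
    exact ⟨⟨Finset.mem_univ v, (hS v hv).1⟩, (hS v hv).2⟩
  have h1 := Finset.card_le_card hsub
  have h2 := Finset.card_filter_add_card_filter_not (s := fib Φ x) (fun v => wt v % 3 = r₀)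
  have h3 := minClass_le Φ x r₀ hr₀
  unfold classCount at h3
  omega

end MinMass

/-! ### §11bis The SHARP fibre theorem: `MassRank` ⟹ cut-free-window strategies of low rank lose -/

section MassFibre
variable {p : ℕ} {L ℓ R : ℕ} (c : ℕ) (y : Fin (L + ℓ + R + 1) → (Fin (L + ℓ + R) → Bool) → Bool)

/-- **Per outside fibre, the losses are at least the min-mass**: if the window `[L, L+ℓ)` is cut-free and every
selector is a function of the sketch `Φv` on each outside fibre, then `#WIN(a ++ · ++ b) + M(Φ) ≤ 2^ℓ`. -/
theorem win_fibre_add_minMass_le (hgap : CutFree y L ℓ) {d : ℕ} (Φ : Fin d → Fin ℓ → ZMod p)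
    (T : Fin (L + ℓ + R + 1) → (Fin L → Bool) → (Fin R → Bool) → (Fin d → ZMod p) → Bool)
    (hT : ∀ (g : Fin (L + ℓ + R + 1)) (a : Fin L → Bool) (b : Fin R → Bool) (v : Fin ℓ → Bool),
      y g (glue3 a v b) = T g a b (skt Φ v))
    (a : Fin L → Bool) (b : Fin R → Bool) :
    (univ.filter fun v : Fin ℓ → Bool => ringWinU c y (glue3 a v b) = true).card + minMass Φ ≤ 2 ^ ℓ := by
  -- the class-`r` fire count is a function of the sketch value
  have hfc : ∀ (v : Fin ℓ → Bool) (r : ℕ), fireCount c y a b r v =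
      (univ.filter fun g : Fin (L + ℓ + R + 1) =>
        T g a b (skt Φ v) = true ∧ gapChar ℓ c a b g.val r % 3 ≠ 0).card := by
    intro v r
    unfold fireCount
    congr 1
    exact Finset.filter_congr fun g _ => by rw [hT g a b v]
  have hwin : ∀ v : Fin ℓ → Bool, ringWinU c y (glue3 a v b) = true ↔
      (univ.filter fun g : Fin (L + ℓ + R + 1) =>
        T g a b (skt Φ v) = true ∧ gapChar ℓ c a b g.val (wt v % 3) % 3 ≠ 0).card % 2 = 1 := by
    intro v
    rw [ringWinU_iff_fireCount c y hgap, fireCount_mod, hfc]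
  rw [Finset.card_eq_sum_card_fiberwise
      (s := univ.filter fun v : Fin ℓ → Bool => ringWinU c y (glue3 a v b) = true)
      (t := univ.image (skt Φ)) (f := skt Φ)
      (fun v _ => Finset.mem_coe.2 (Finset.mem_image_of_mem _ (Finset.mem_univ v))),
    ← sum_card_fib Φ]
  unfold minMass
  rw [← Finset.sum_add_distrib]
  refine Finset.sum_le_sum fun x hx => ?_
  obtain ⟨v₀, _, hv₀⟩ := Finset.mem_image.1 hx
  -- at `x` not all three classes fire oddly
  have h3 := not_three_odd c y a b v₀
  rw [hfc, hfc, hfc, hv₀] at h3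
  have hex : ∃ r₀, r₀ < 3 ∧ ¬ ((univ.filter fun g : Fin (L + ℓ + R + 1) =>
      T g a b x = true ∧ gapChar ℓ c a b g.val r₀ % 3 ≠ 0).card % 2 = 1) := by
    by_cases h0 : (univ.filter fun g : Fin (L + ℓ + R + 1) =>
        T g a b x = true ∧ gapChar ℓ c a b g.val 0 % 3 ≠ 0).card % 2 = 1
    · by_cases h1 : (univ.filter fun g : Fin (L + ℓ + R + 1) =>
          T g a b x = true ∧ gapChar ℓ c a b g.val 1 % 3 ≠ 0).card % 2 = 1
      · exact ⟨2, by norm_num, fun h2 => h3 ⟨h0, h1, h2⟩⟩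
      · exact ⟨1, by norm_num, h1⟩
    · exact ⟨0, by norm_num, h0⟩
  obtain ⟨r₀, hr₀, hW⟩ := hex
  refine card_add_minClass_le Φ x _ r₀ hr₀ fun v hv => ?_
  rw [Finset.mem_filter, Finset.mem_filter] at hv
  refine ⟨hv.2, fun hr => hW ?_⟩
  have hw := (hwin v).1 hv.1.2
  rw [hv.2, hr] at hw
  exact hw

/-- **THE SHARP FIBRE THEOREM.**  `MassRank p r` ⟹ every strategy on `n = L + ℓ + R` bits (selector tables
ARBITRARY) with the window `[L, L+ℓ)` cut-free and of sketch dimension `≤ r(ℓ)`, `ℓ ≥ ℓ₀`, satisfies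
`C·#WIN ≤ (C−1)·2ⁿ`. -/
theorem window_bound_of_massRank {p : ℕ} {r : ℕ → ℕ} (hM : MassRank p r) :
    ∃ C ℓ₀ : ℕ, 0 < C ∧ ∀ (L ℓ R : ℕ), ℓ₀ ≤ ℓ →
      ∀ (c : ℕ) (y : Fin (L + ℓ + R + 1) → (Fin (L + ℓ + R) → Bool) → Bool),
        CutFree y L ℓ → RankLE p y (r ℓ) →
        C * (univ.filter fun u : Fin (L + ℓ + R) → Bool => ringWinU c y u = true).card ≤ (C - 1) * 2 ^ (L + ℓ + R) := by
  obtain ⟨C, ℓ₀, hlaw⟩ := hM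
  have hC : 0 < C := by
    have h := hlaw ℓ₀ le_rfl 0 (Nat.zero_le _) (fun k => Fin.elim0 k)
    rcases Nat.eq_zero_or_pos C with h0 | h0
    · rw [h0, zero_mul] at h
      exact absurd h (not_le.2 (Nat.two_pow_pos ℓ₀))
    · exact h0
  refine ⟨C, ℓ₀, hC, fun L ℓ R hℓ c y hgap hrank => ?_⟩
  obtain ⟨d, hd, Φ, hΦ⟩ := hrank
  choose T hT using hΦ
  have hmass := hlaw ℓ hℓ d hd Φ
  have hfib : ∀ (a : Fin L → Bool) (b : Fin R → Bool),
      C * (univ.filter fun v : Fin ℓ → Bool => ringWinU c y (glue3 a v b) = true).card ≤ (C - 1) * 2 ^ ℓ := by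
    intro a b
    have h1 := Nat.mul_le_mul_left C (win_fibre_add_minMass_le c y hgap Φ T hT a b)
    rw [Nat.mul_add] at h1
    have h2 : C * (univ.filter fun v : Fin ℓ → Bool => ringWinU c y (glue3 a v b) = true).card + 2 ^ ℓ ≤
        C * 2 ^ ℓ := le_trans (Nat.add_le_add_left hmass _) h1
    rw [Nat.sub_one_mul]
    exact Nat.le_sub_of_add_le h2
  rw [card_filter_eq_sum_glue3 (fun w => ringWinU c y w = true), Finset.mul_sum]
  calc ∑ a : Fin L → Bool, C * ∑ b : Fin R → Bool,
        (univ.filter fun v : Fin ℓ → Bool => ringWinU c y (glue3 a v b) = true).card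
      ≤ ∑ _a : Fin L → Bool, 2 ^ R * ((C - 1) * 2 ^ ℓ) := by
        refine Finset.sum_le_sum fun a _ => ?_
        rw [Finset.mul_sum]
        calc ∑ b : Fin R → Bool, C * (univ.filter fun v : Fin ℓ → Bool => ringWinU c y (glue3 a v b) = true).card
            ≤ ∑ _b : Fin R → Bool, (C - 1) * 2 ^ ℓ := Finset.sum_le_sum fun b _ => hfib a b
          _ = 2 ^ R * ((C - 1) * 2 ^ ℓ) := by
            rw [Finset.sum_const, Finset.card_univ, Fintype.card_fun, Fintype.card_bool, Fintype.card_fin,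
              smul_eq_mul]
    _ = 2 ^ L * (2 ^ R * ((C - 1) * 2 ^ ℓ)) := by
        rw [Finset.sum_const, Finset.card_univ, Fintype.card_fun, Fintype.card_bool, Fintype.card_fin,
          smul_eq_mul]
    _ = (C - 1) * 2 ^ (L + ℓ + R) := by rw [pow_add, pow_add]; ring

/-- The sharp fibre theorem as a real fraction: `#WIN ≤ (1 − 1/C)·2ⁿ`. -/
theorem window_bound_of_massRank_real {p : ℕ} {r : ℕ → ℕ} (hM : MassRank p r) :
    ∃ θ : ℝ, θ < 1 ∧ ∃ ℓ₀ : ℕ, ∀ (L ℓ R : ℕ), ℓ₀ ≤ ℓ →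
      ∀ (c : ℕ) (y : Fin (L + ℓ + R + 1) → (Fin (L + ℓ + R) → Bool) → Bool),
        CutFree y L ℓ → RankLE p y (r ℓ) →
        ((univ.filter fun u : Fin (L + ℓ + R) → Bool => ringWinU c y u = true).card : ℝ) ≤
          θ * (2 : ℝ) ^ (L + ℓ + R) := by
  obtain ⟨C, ℓ₀, hC, h⟩ := window_bound_of_massRank hM
  have hCr : (0 : ℝ) < C := by exact_mod_cast hC
  refine ⟨((C : ℝ) - 1) / C, by rw [div_lt_one hCr]; linarith, ℓ₀, fun L ℓ R hℓ c y hgap hrank => ?_⟩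
  have h' := h L ℓ R hℓ c y hgap hrank
  have h'' : (C : ℝ) * ((univ.filter fun u : Fin (L + ℓ + R) → Bool => ringWinU c y u = true).card : ℝ) ≤
      ((C - 1 : ℕ) : ℝ) * (2 : ℝ) ^ (L + ℓ + R) := by exact_mod_cast h'
  rw [Nat.cast_sub hC, Nat.cast_one] at h''
  rw [div_mul_eq_mul_div, le_div_iff₀ hCr]
  linarith

/-- **`MassRankLin p ⟹ WindowRankSel p`** (general tables) — the low-rank window piece through the sharp law. -/
theorem windowRankSel_of_massRankLin {p : ℕ} (h : MassRankLin p) : WindowRankSel p := by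
  obtain ⟨E, hE, hM⟩ := h
  obtain ⟨θ, hθ, ℓ₀, hW⟩ := window_bound_of_massRank_real hM
  exact ⟨E, hE, θ, hθ, ℓ₀, fun L ℓ R hℓ c y hgap hrank => hW L ℓ R hℓ c y hgap hrank⟩

end MassFibre

end Summit.QuantumAdvantage.QuantumAdvantage.Theorems.RankDial

end
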